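import Mathlib.Geometry.Manifold.Diffeomorph
import HarnessLib

/-!
# Making a chart of the maximal atlas the preferred chart

Topic `Literature/Geometry/Manifold`. A smooth structure is its maximal atlas, not the particular
atlas (let alone the particular *preferred* charts `chartAt`) used to present it (J. M. Lee,
*Introduction to Smooth Manifolds*, 2nd ed. (2013), Prop. 1.17: two smooth atlases determine the
same smooth structure iff their union is a smooth atlas). Mathlib's `ChartedSpace H M` fixes a
preferred chart `chartAt H x` at every point, and several statements of the tree are phrased
through `chartAt` / `extChartAt` at a distinguished point (e.g. "a form standard near `p` in the
chart at `p`"). This file provides the book-keeping that lets such statements be applied to an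
ARBITRARY chart `χ` of the maximal `C^n` atlas:

* `WithPreferredChart M χ` — a type synonym for `M` (same points, same topology) whose charted
  space structure has atlas `insert χ (atlas H M)` and whose preferred chart at every point of
  `χ.source` is `χ` (elsewhere the old preferred chart): `chartAt_of_mem_source`;
* if `χ ∈ IsManifold.maximalAtlas I n M` then `WithPreferredChart M χ` is a `C^n` manifold with
  the SAME maximal atlas (`isManifold`, `maximalAtlas_eq`), and the identity map is a `C^n`
  diffeomorphism `toOrig : WithPreferredChart M χ ≃ₘ^n⟮I, I⟯ M` (`toOrig_apply`,
  `toOrig_symm_apply`);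
* the separation / countability / compactness / connectedness instances are those of `M`.

Everything is proved; no named facts. (Compare `Literature/Geometry/Manifold/BoundarylessRechart`
and `…/TransferStructure`, which change the model space, resp. the carrier; here only the
preferred charts change.)

## References

* J. M. Lee, *Introduction to Smooth Manifolds*, 2nd ed., GTM 218, Springer (2013), Ch. 1,
  Prop. 1.17 [LeeSmoothManifolds2013].
-/

noncomputable section

open Set Function Filter
open scoped Manifold ContDiff Topology

namespace Literature.Geometry.Manifold

universe u v

variable {H : Type u} [TopologicalSpace H]

/-- **`M` with `χ` declared the preferred chart on its source**: a type synonym for `M`; the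
charted space structure is `WithPreferredChart.instChartedSpace`. (Lee 2013, Prop. 1.17: the
smooth structure depends only on the maximal atlas.) [cite: LeeSmoothManifolds2013, Ch. 1, Prop. 1.17] -/
@[nolint unusedArguments]
def WithPreferredChart (M : Type v) [TopologicalSpace M] (_χ : OpenPartialHomeomorph M H) :
    Type v := M

namespace WithPreferredChart

variable {M : Type v} [TopologicalSpace M] {χ : OpenPartialHomeomorph M H}

/-- The topology of `WithPreferredChart M χ` is that of `M`. [folklore] -/
instance instTopologicalSpace : TopologicalSpace (WithPreferredChart M χ) :=
  ‹TopologicalSpace M›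

/-- Hausdorffness is inherited from `M`. [folklore] -/
instance instT2Space [T2Space M] : T2Space (WithPreferredChart M χ) := ‹T2Space M›

/-- The `T₁` property is inherited from `M`. [folklore] -/
instance instT1Space [T1Space M] : T1Space (WithPreferredChart M χ) := ‹T1Space M›

/-- Second countability is inherited from `M`. [folklore] -/
instance instSecondCountableTopology [SecondCountableTopology M] :
    SecondCountableTopology (WithPreferredChart M χ) := ‹SecondCountableTopology M›

/-- Compactness is inherited from `M`. [folklore] -/
instance instCompactSpace [CompactSpace M] : CompactSpace (WithPreferredChart M χ) :=
  ‹CompactSpace M›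

/-- Local compactness is inherited from `M`. [folklore] -/
instance instLocallyCompactSpace [LocallyCompactSpace M] :
    LocallyCompactSpace (WithPreferredChart M χ) := ‹LocallyCompactSpace M›

/-- σ-compactness is inherited from `M`. [folklore] -/
instance instSigmaCompactSpace [SigmaCompactSpace M] :
    SigmaCompactSpace (WithPreferredChart M χ) := ‹SigmaCompactSpace M›

/-- Connectedness is inherited from `M`. [folklore] -/
instance instConnectedSpace [ConnectedSpace M] : ConnectedSpace (WithPreferredChart M χ) :=
  ‹ConnectedSpace M›

/-- Path-connectedness is inherited from `M`. [folklore] -/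
instance instPathConnectedSpace [PathConnectedSpace M] :
    PathConnectedSpace (WithPreferredChart M χ) := ‹PathConnectedSpace M›

/-- Non-emptiness is inherited from `M`. [folklore] -/
instance instNonempty [Nonempty M] : Nonempty (WithPreferredChart M χ) := ‹Nonempty M›

variable (χ) in
/-- The identity of `M` as an equivalence of types `WithPreferredChart M χ ≃ M` (use it to move
points between the two copies without ambiguity about the charted space structure). [folklore] -/
protected def equiv : WithPreferredChart M χ ≃ M := Equiv.refl M

/-- `WithPreferredChart.equiv` is the identity on points. [folklore] -/
@[simp] theorem equiv_apply (x : WithPreferredChart M χ) :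
    WithPreferredChart.equiv χ x = (x : M) := rfl

/-- `WithPreferredChart.equiv.symm` is the identity on points. [folklore] -/
@[simp] theorem equiv_symm_apply (x : M) :
    (WithPreferredChart.equiv χ).symm x = (x : WithPreferredChart M χ) := rfl

variable [ChartedSpace H M]

open Classical in
/-- **The charted space structure with `χ` preferred on its source**: atlas
`insert χ (atlas H M)`; the chart at `x` is `χ` if `x ∈ χ.source` and the old `chartAt H x`
otherwise. (Lee 2013, Prop. 1.17.) [cite: LeeSmoothManifolds2013, Ch. 1, Prop. 1.17] -/
instance instChartedSpace : ChartedSpace H (WithPreferredChart M χ) where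
  atlas := insert χ (atlas H M)
  chartAt x := if (x : M) ∈ χ.source then χ else chartAt H (M := M) x
  mem_chart_source x := by
    by_cases hx : (x : M) ∈ χ.source
    · rw [if_pos hx]; exact hx
    · rw [if_neg hx]; exact mem_chart_source H (M := M) x
  chart_mem_atlas x := by
    by_cases hx : (x : M) ∈ χ.source
    · rw [if_pos hx]; exact mem_insert _ _
    · rw [if_neg hx]; exact mem_insert_of_mem _ (chart_mem_atlas H (M := M) x)

/-- The atlas of `WithPreferredChart M χ` is `insert χ (atlas H M)`. [folklore] -/
theorem atlas_eq : atlas H (WithPreferredChart M χ) = insert χ (atlas H M) := rfl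

/-- `χ` is a chart of the new atlas. [folklore] -/
theorem mem_atlas_self : χ ∈ atlas H (WithPreferredChart M χ) := mem_insert _ _

/-- The old charts are charts of the new atlas. [folklore] -/
theorem mem_atlas_of_mem {e : OpenPartialHomeomorph M H} (he : e ∈ atlas H M) :
    e ∈ atlas H (WithPreferredChart M χ) :=
  mem_insert_of_mem _ he

open Classical in
/-- **On `χ.source` the preferred chart is `χ`.** [cite: LeeSmoothManifolds2013, Ch. 1, Prop. 1.17] -/
theorem chartAt_of_mem_source {x : WithPreferredChart M χ} (hx : (x : M) ∈ χ.source) :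
    chartAt H x = χ := by
  show (if (x : M) ∈ χ.source then χ else chartAt H (M := M) x) = χ
  rw [if_pos hx]

open Classical in
/-- Off `χ.source` the preferred chart is the old one. [folklore] -/
theorem chartAt_of_not_mem_source {x : WithPreferredChart M χ}
    (hx : (x : M) ∉ χ.source) : chartAt H x = chartAt H (M := M) x := by
  show (if (x : M) ∈ χ.source then χ else chartAt H (M := M) x) = _
  rw [if_neg hx]

/-- On `χ.source` the extended preferred chart is `χ.extend I`. [folklore] -/
theorem extChartAt_of_mem_source {𝕜 : Type*} [NontriviallyNormedField 𝕜] {E : Type*}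
    [NormedAddCommGroup E] [NormedSpace 𝕜 E] (I : ModelWithCorners 𝕜 E H)
    {x : WithPreferredChart M χ} (hx : (x : M) ∈ χ.source) :
    extChartAt I x = χ.extend I := by
  rw [extChartAt, chartAt_of_mem_source hx]
  rfl

section Smooth

variable {𝕜 : Type*} [NontriviallyNormedField 𝕜] {E : Type*} [NormedAddCommGroup E]
  [NormedSpace 𝕜 E] {I : ModelWithCorners 𝕜 E H} {n : ℕ∞ω}

/-- A chart of the new atlas lies in the maximal `C^n` atlas of `M`, provided `χ` does.
[folklore] -/
theorem mem_maximalAtlas_of_mem_atlas [IsManifold I n M]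
    (hχ : χ ∈ IsManifold.maximalAtlas I n M) {e : OpenPartialHomeomorph M H}
    (he : e ∈ atlas H (WithPreferredChart M χ)) : e ∈ IsManifold.maximalAtlas I n M := by
  rcases (mem_insert_iff.1 he) with rfl | he'
  · exact hχ
  · exact IsManifold.subset_maximalAtlas he'

/-- **`WithPreferredChart M χ` is a `C^n` manifold** when `χ` is a chart of the maximal `C^n`
atlas of the `C^n` manifold `M`: any two charts of `insert χ (atlas H M)` lie in that maximal
atlas, hence are `C^n` compatible. (Lee 2013, Prop. 1.17(a).) [cite: LeeSmoothManifolds2013, Ch. 1, Prop. 1.17] -/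
theorem isManifold [IsManifold I n M] (hχ : χ ∈ IsManifold.maximalAtlas I n M) :
    IsManifold I n (WithPreferredChart M χ) := by
  haveI : HasGroupoid (WithPreferredChart M χ) (contDiffGroupoid n I) :=
    { compatible := fun he he' => by
        have key := IsManifold.compatible_of_mem_maximalAtlas
          (mem_maximalAtlas_of_mem_atlas hχ he) (mem_maximalAtlas_of_mem_atlas hχ he')
        exact key }
  exact IsManifold.mk' I n _

/-- **The maximal atlas is unchanged**: a chart is `C^n` compatible with `insert χ (atlas H M)`
iff it is `C^n` compatible with `atlas H M` (for `χ` in the maximal atlas). (Lee 2013,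
Prop. 1.17(b).) [cite: LeeSmoothManifolds2013, Ch. 1, Prop. 1.17] -/
theorem maximalAtlas_eq [IsManifold I n M] (hχ : χ ∈ IsManifold.maximalAtlas I n M) :
    IsManifold.maximalAtlas I n (WithPreferredChart M χ) = IsManifold.maximalAtlas I n M := by
  ext e
  constructor
  · intro he e' he'
    exact he e' (mem_atlas_of_mem he')
  · intro he e' he'
    have h' : e' ∈ IsManifold.maximalAtlas I n M := mem_maximalAtlas_of_mem_atlas hχ he'
    have h1 := IsManifold.compatible_of_mem_maximalAtlas he h'
    have h2 := IsManifold.compatible_of_mem_maximalAtlas h' he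
    exact ⟨h1, h2⟩

/-- `χ` lies in the maximal atlas of `WithPreferredChart M χ` (it is even in the atlas).
[folklore] -/
theorem self_mem_maximalAtlas [IsManifold I n M] (hχ : χ ∈ IsManifold.maximalAtlas I n M) :
    χ ∈ IsManifold.maximalAtlas I n (WithPreferredChart M χ) := by
  rw [maximalAtlas_eq hχ]; exact hχ

omit [ChartedSpace H M] in
/-- The identity read in a chart `c` on both sides is `C^n` within `range I`: it agrees with the
identity of `E` on the target of `c.extend I`. [folklore] -/
theorem contDiffWithinAt_extend_comp_symm (c : OpenPartialHomeomorph M H) {x : M}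
    (hx : x ∈ c.source) :
    ContDiffWithinAt 𝕜 n (c.extend I ∘ (c.extend I).symm) (range I) (c.extend I x) := by
  refine contDiffWithinAt_id.congr_of_eventuallyEq_of_mem ?_
    (by simpa only [c.extend_coe, comp_apply] using mem_range_self _)
  filter_upwards [c.extend_target_mem_nhdsWithin (I := I) hx] with z hz
  exact (c.extend I).right_inv hz

/-- **The identity `WithPreferredChart M χ → M` is `C^n`** (read in the old chart at `x` on
both sides, a member of both maximal atlases, it is the identity of `E`). [cite: LeeSmoothManifolds2013, Ch. 1, Prop. 1.17] -/
theorem contMDiff_equiv [IsManifold I n M] (hχ : χ ∈ IsManifold.maximalAtlas I n M) :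
    ContMDiff I I n (WithPreferredChart.equiv χ) := by
  intro x
  set c : OpenPartialHomeomorph M H := chartAt H (WithPreferredChart.equiv χ x) with hc
  have hcM : c ∈ IsManifold.maximalAtlas I n M := IsManifold.chart_mem_maximalAtlas _
  have hcW : c ∈ IsManifold.maximalAtlas I n (WithPreferredChart M χ) := by
    rw [maximalAtlas_eq hχ]; exact hcM
  have hx : WithPreferredChart.equiv χ x ∈ c.source := mem_chart_source H _
  have hx' : (x : M) ∈ c.source := hx
  rw [contMDiffAt_iff_of_mem_maximalAtlas hcW hcM hx' hx]
  exact ⟨continuousAt_id, contDiffWithinAt_extend_comp_symm c hx⟩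

/-- **The identity `M → WithPreferredChart M χ` is `C^n`.** [cite: LeeSmoothManifolds2013, Ch. 1, Prop. 1.17] -/
theorem contMDiff_equiv_symm [IsManifold I n M] (hχ : χ ∈ IsManifold.maximalAtlas I n M) :
    ContMDiff I I n (WithPreferredChart.equiv χ).symm := by
  intro x
  set c : OpenPartialHomeomorph M H := chartAt H x with hc
  have hcM : c ∈ IsManifold.maximalAtlas I n M := IsManifold.chart_mem_maximalAtlas _
  have hcW : c ∈ IsManifold.maximalAtlas I n (WithPreferredChart M χ) := by
    rw [maximalAtlas_eq hχ]; exact hcM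
  have hx : x ∈ c.source := mem_chart_source H _
  rw [contMDiffAt_iff_of_mem_maximalAtlas hcM hcW hx hx]
  exact ⟨continuousAt_id, contDiffWithinAt_extend_comp_symm c hx⟩

/-- **The identity diffeomorphism `WithPreferredChart M χ ≃ₘ^n M`**: changing the preferred
charts inside the maximal atlas does not change the smooth manifold. (Lee 2013, Prop. 1.17.)
[cite: LeeSmoothManifolds2013, Ch. 1, Prop. 1.17] -/
def toOrig [IsManifold I n M] (hχ : χ ∈ IsManifold.maximalAtlas I n M) :
    WithPreferredChart M χ ≃ₘ^n⟮I, I⟯ M where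
  toEquiv := WithPreferredChart.equiv χ
  contMDiff_toFun := contMDiff_equiv hχ
  contMDiff_invFun := contMDiff_equiv_symm hχ

/-- `toOrig` is the identity on points. [folklore] -/
@[simp] theorem toOrig_apply [IsManifold I n M] (hχ : χ ∈ IsManifold.maximalAtlas I n M)
    (x : WithPreferredChart M χ) : toOrig hχ x = WithPreferredChart.equiv χ x := rfl

/-- `toOrig.symm` is the identity on points. [folklore] -/
@[simp] theorem toOrig_symm_apply [IsManifold I n M] (hχ : χ ∈ IsManifold.maximalAtlas I n M)
    (x : M) : (toOrig (I := I) (n := n) hχ).symm x = (WithPreferredChart.equiv χ).symm x := rfl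

end Smooth

end WithPreferredChart

end Literature.Geometry.Manifold

end
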